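import Literature.AlgebraicGeometry.Villaflor2022.LinearCycleTransitionDeterminant
import Literature.AlgebraicGeometry.Villaflor2022.LinearFormsCutLinearCycle
import HarnessLib

/-!
# `det Jac(H) = sign(b)·d^{n/2+1}·P_δ/c_δ` for Movasati–Villaflor's linear cycle `ℙ^{n/2}_{a,b}` in the coordinates
# `x_0, …, x_{n+1}` (Villaflor Loyola, manuscripta math. 167 (2022), Cor. 4 eq. (cycllinfer); MV18 Thm. 1's `sign(b)`)

Certified instances and evidence bearing on the general Hodge conjecture; no claim.

This is the companion of `Villaflor2022/LinearCycleTransitionDeterminant.lean` (eq. (cycllinfer) in the abstract pair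
vocabulary `τ ⊕ τ`) in the CENSUS PARAMETRISATION of the tree (`MovasatiVillaflor2018.pairEquiv`, `.twist`,
`Villaflor2022.linearCyclePolyMV`; section "The census parametrisation" of `LinearFormsCutLinearCycle.lean`):
`n` even, variables `x_0, …, x_{n+1}` (`Fin (n+2)`), a pairing `b ∈ 𝔖_{n+2}` and twist exponents `a`, the linear cycle
of [MovasatiVillaflor2018] §1

  `ℙ^{n/2}_{a,b} : x_{b(2e)} − ζ^{1+2a_{2e+1}} x_{b(2e+1)} = 0   (e = 0, …, n/2)`

of the Fermat variety `x_0^d + ⋯ + x_{n+1}^d = 0` (`ζ^d = −1`). Villaflor's presentation ([Villaflor2022PeriodsCI] Thm. 1: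
"Write `F = f_1g_1 + ⋯ + f_{n/2+1}g_{n/2+1}`, and define `H = (h_0, …, h_{n+1}) := (f_1, g_1, …, f_{n/2+1}, g_{n/2+1})`")
is, for this cycle,

  `h_{2e} = f_{e} = x_{b(2e)} − c_e x_{b(2e+1)}`,  `h_{2e+1} = g_{e} = Σ_{l<d} x_{b(2e)}^l (c_e x_{b(2e+1)})^{d−1−l}`,  `c_e = ζ^{1+2a_{2e+1}}`

(written in place as `rename ((pairEquiv n).trans b) (Sum.elim f g ((pairEquiv n).symm i))`, unfolded by
`presentationMV_even`, `presentationMV_odd`), with `Σ_e h_{2e}h_{2e+1} = Σ_i x_i^d`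
(`sum_presentationMV_mul`), and its TRANSITION DETERMINANT `det Jac(H) = det(∂h_i/∂x_j)_{i,j = 0..n+1}` is

  **`det Jac(H) = sign(b) · d^{n/2+1} · linearCyclePolyMV n d ζ a b`**   (`det_jacobian_presentationMV`),

where `linearCyclePolyMV = ζ^{Σ_e(1+2a_{2e+1})}·∏_e Σ_{l<d−1} x_{b(2e)}^l (c_e x_{b(2e+1)})^{d−2−l}` is Villaflor's normalised
`P_δ/c_δ` ([Villaflorloyola2021] Prop. 5.2) already in the tree: [Villaflor2022PeriodsCI] Cor. 4, eq. (cycllinfer)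
`P_δ = d^{n/2+1} ζ^{α_0+α_2+⋯+α_n} ∏_j (Σ_l x_{2j−2}^{d−2−l} ζ^{α_{2j−2}l} x_{2j−1}^l)` for `b = 1`, and for a general
pairing `b` the orientation sign `sign(b)` of [MovasatiVillaflor2018] Thm. 1 (the columns of `Jac(H)` are the
variables in their natural order `x_0, …, x_{n+1}`, the rows are `(f_1, g_1, f_2, g_2, …)`; re-pairing the columns by
`b` costs `sign(b)`). In the cell pub-hlocus this is exactly engine B's 'cycle polynomial' `det Jac` of a linear
cycle given by `(a, b)` (record og81/MU0-SURFACES-ALLD-g31.md §8 THEOREM D (1): "`det Jac = sgn_Z·d^k·Π_e u_{c_e}`").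
Theorem-only file: 0 definitions, 0 named facts, 0 sorry.
-/

noncomputable section

open MvPolynomial Matrix Literature.AlgebraicGeometry.HodgeTheory Literature.AlgebraicGeometry.MovasatiVillaflor2018

namespace Literature.AlgebraicGeometry.Villaflor2022

variable {K : Type*} [Field K] {n : ℕ}

/-- The twists `c_e = ζ^{1+2a_{2e+1}}` are `d`-th roots of `−1` when `ζ^d = −1`. [cite: MovasatiVillaflor2018, §1] -/
private theorem twist_pow_eq_neg_one' {d : ℕ} {ζ : K} (hζ : ζ ^ d = -1) (a : Fin (n + 2) → ℕ)
    (e : Fin (n / 2 + 1)) : twist n ζ a e ^ d = -1 := by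
  rw [twist, ← pow_mul, mul_comm, pow_mul, hζ]
  exact Odd.neg_one_pow ⟨a ⟨2 * e + 1, by omega⟩, by ring⟩

/-! ## Villaflor's `H = (f_1, g_1, …, f_{n/2+1}, g_{n/2+1})` for `ℙ^{n/2}_{a,b}` -/

/-- **`h_{2e} = x_{b(2e)} − ζ^{1+2a_{2e+1}} x_{b(2e+1)}`**: the even entries of Villaflor's `H` for `ℙ^{n/2}_{a,b}` are
the equations of the cycle. (`H_i := rename ((pairEquiv n).trans b) (Sum.elim f g ((pairEquiv n).symm i))` with the
abstract presentation `f_e = x_{2e} − c_e x_{2e+1}`, `g_e = fermatLinearCycleFactor c d e` of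
`LinearCycleTransitionDeterminant.lean`, `c = twist n ζ a`.) [cite: Villaflor2022PeriodsCI, Theorem 1, Corollary 4] [cite: MovasatiVillaflor2018, §1] -/
theorem presentationMV_even (hn : Even n) (d : ℕ) (ζ : K) (a : Fin (n + 2) → ℕ) (b : Equiv.Perm (Fin (n + 2)))
    (e : Fin (n / 2 + 1)) :
    rename ((pairEquiv n hn).trans b) (Sum.elim
        (fun e => (X (Sum.inl e) : MvPolynomial _ K) - C (twist n ζ a e) * X (Sum.inr e))
        (fermatLinearCycleFactor (twist n ζ a) d) ((pairEquiv n hn).symm (pairEquiv n hn (Sum.inl e)))) =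
      X (b ⟨2 * e, by omega⟩) - C (twist n ζ a e) * X (b ⟨2 * e + 1, by omega⟩) := by
  rw [Equiv.symm_apply_apply, Sum.elim_inl, map_sub, map_mul, rename_C, rename_X, rename_X, Equiv.trans_apply,
    Equiv.trans_apply, pairEquiv_inl, pairEquiv_inr]

/-- **`h_{2e+1} = Σ_{l<d} x_{b(2e)}^l (ζ^{1+2a_{2e+1}} x_{b(2e+1)})^{d−1−l}`**: the odd entries of `H` are the cofactors
`g_e = (x_{b(2e)}^d + x_{b(2e+1)}^d)/(x_{b(2e)} − c_e x_{b(2e+1)})`. [cite: Villaflor2022PeriodsCI, Theorem 1, Corollary 4 (proof)] [cite: MovasatiVillaflor2018, §1] -/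
theorem presentationMV_odd (hn : Even n) (d : ℕ) (ζ : K) (a : Fin (n + 2) → ℕ) (b : Equiv.Perm (Fin (n + 2)))
    (e : Fin (n / 2 + 1)) :
    rename ((pairEquiv n hn).trans b) (Sum.elim
        (fun e => (X (Sum.inl e) : MvPolynomial _ K) - C (twist n ζ a e) * X (Sum.inr e))
        (fermatLinearCycleFactor (twist n ζ a) d) ((pairEquiv n hn).symm (pairEquiv n hn (Sum.inr e)))) =
      ∑ l ∈ Finset.range d, X (b ⟨2 * e, by omega⟩) ^ l * (C (twist n ζ a e) * X (b ⟨2 * e + 1, by omega⟩)) ^ (d - 1 - l) := by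
  rw [Equiv.symm_apply_apply, Sum.elim_inr, fermatLinearCycleFactor, map_sum]
  refine Finset.sum_congr rfl fun l _ => ?_
  rw [map_mul, map_pow, map_pow, map_mul, rename_C, rename_X, rename_X, Equiv.trans_apply, Equiv.trans_apply,
    pairEquiv_inl, pairEquiv_inr]

/-- "Write `F = f_1g_1 + ⋯ + f_{n/2+1}g_{n/2+1}`": `Σ_e h_{2e}·h_{2e+1} = x_0^d + ⋯ + x_{n+1}^d` for `ζ^d = −1`.
[cite: Villaflor2022PeriodsCI, Theorem 1, Corollary 4] [cite: MovasatiVillaflor2018, §1] -/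
theorem sum_presentationMV_mul (hn : Even n) {d : ℕ} {ζ : K} (hζ : ζ ^ d = -1) (a : Fin (n + 2) → ℕ)
    (b : Equiv.Perm (Fin (n + 2))) :
    ∑ e : Fin (n / 2 + 1),
      (X (b ⟨2 * e, by omega⟩) - C (twist n ζ a e) * X (b ⟨2 * e + 1, by omega⟩)) *
        (∑ l ∈ Finset.range d, X (b ⟨2 * e, by omega⟩) ^ l * (C (twist n ζ a e) * X (b ⟨2 * e + 1, by omega⟩)) ^ (d - 1 - l)) =
      ∑ i : Fin (n + 2), (X i : MvPolynomial (Fin (n + 2)) K) ^ d := by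
  have h := congr_arg (rename ((pairEquiv n hn).trans b))
    (sum_linearForm_mul_fermatLinearCycleFactor (twist n ζ a) d (twist_pow_eq_neg_one' hζ a))
  rw [map_sum, map_sum] at h
  simp only [map_mul, map_sub, map_pow, rename_X, rename_C, Equiv.trans_apply, pairEquiv_inl, pairEquiv_inr,
    fermatLinearCycleFactor, map_sum] at h
  rw [h]
  exact Fintype.sum_equiv ((pairEquiv n hn).trans b) _ _ fun _ => rfl

/-! ## The transition determinant in the coordinates `x_0, …, x_{n+1}` -/

/-- **[Villaflor2022PeriodsCI] Cor. 4, eq. (cycllinfer), with [MovasatiVillaflor2018] Thm. 1's `sign(b)`.** For the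
linear cycle `ℙ^{n/2}_{a,b}` and Villaflor's `H = (h_0, …, h_{n+1})` (`h_{2e} = x_{b(2e)} − c_e x_{b(2e+1)}`,
`h_{2e+1} = Σ_{l<d} x_{b(2e)}^l (c_e x_{b(2e+1)})^{d−1−l}`, `c_e = ζ^{1+2a_{2e+1}}`; `presentationMV_even/odd`), the Jacobian
determinant with respect to `x_0, …, x_{n+1}` is
`det (∂h_i/∂x_j)_{i,j} = sign(b) · d^{n/2+1} · linearCyclePolyMV n d ζ a b`
(`= sign(b)·d^{n/2+1}·ζ^{Σ_e(1+2a_{2e+1})}·∏_e Σ_{l<d−1} x_{b(2e)}^l (c_e x_{b(2e+1)})^{d−2−l}`), for every `d ≥ 1`, every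
`ζ`, `a`, `b`. [cite: Villaflor2022PeriodsCI, Corollary 4, eq. (cycllinfer)] [cite: MovasatiVillaflor2018, Theorem 1] [cite: Villaflorloyola2021, Proposition 5.2] -/
theorem det_jacobian_presentationMV (hn : Even n) {d : ℕ} (hd : 1 ≤ d) (ζ : K) (a : Fin (n + 2) → ℕ)
    (b : Equiv.Perm (Fin (n + 2))) :
    (Matrix.of fun i j : Fin (n + 2) => pderiv j (rename ((pairEquiv n hn).trans b) (Sum.elim
        (fun e => (X (Sum.inl e) : MvPolynomial _ K) - C (twist n ζ a e) * X (Sum.inr e))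
        (fermatLinearCycleFactor (twist n ζ a) d) ((pairEquiv n hn).symm i)))).det =
      ((Equiv.Perm.sign b : ℤ) : MvPolynomial (Fin (n + 2)) K) *
        (C ((d : K) ^ (n / 2 + 1)) * linearCyclePolyMV n d ζ a b hn) := by
  set pe := pairEquiv n hn with hpe
  set ρ := pe.trans b with hρ
  set c := twist n ζ a with hc
  set H : Fin (n / 2 + 1) ⊕ Fin (n / 2 + 1) → MvPolynomial (Fin (n / 2 + 1) ⊕ Fin (n / 2 + 1)) K := Sum.elim
    (fun e => (X (Sum.inl e) : MvPolynomial _ K) - C (c e) * X (Sum.inr e)) (fermatLinearCycleFactor c d) with hH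
  have hmat : (Matrix.of fun i j : Fin (n + 2) => pderiv j (rename ρ (H (pe.symm i)))) =
      (Matrix.of fun p q : Fin (n / 2 + 1) ⊕ Fin (n / 2 + 1) => pderiv (pe q) (rename ρ (H p))).submatrix
        pe.symm pe.symm := by
    refine Matrix.ext fun i j => ?_
    rw [Matrix.submatrix_apply, Matrix.of_apply, Matrix.of_apply, Equiv.apply_symm_apply]
  have hperm : ρ.symm.trans pe = Equiv.symm b := by
    ext x
    rw [hρ, Equiv.trans_apply, Equiv.symm_trans_apply, Equiv.apply_symm_apply]
  rw [hmat, Matrix.det_submatrix_equiv_self, hH, det_jacobian_rename c d ρ pe hd, hperm, Equiv.Perm.sign_symm,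
    map_mul, rename_C, map_mul, Fintype.card_fin, mul_assoc]
  rfl

/-- The constant-free reading (`d ≥ 2`, `d ≠ 0` in `K`, `ζ ≠ 0`): `det Jac(H) ∉ J^F = (x_i^{d−1})` — the transition
determinant of `ℙ^{n/2}_{a,b}` is a non-zero class in the Jacobian ring of the Fermat polynomial (the primitive class
`[ℙ^{n/2}]_prim ≠ 0` of Theorem 1, algebraic shadow). [cite: Villaflor2022PeriodsCI, Theorem 1, Corollary 4] [cite: MovasatiVillaflor2018, Theorem 1] -/
theorem det_jacobian_presentationMV_not_mem (hn : Even n) {d : ℕ} (hd : 2 ≤ d) (hdK : (d : K) ≠ 0) {ζ : K}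
    (hζ : ζ ≠ 0) (a : Fin (n + 2) → ℕ) (b : Equiv.Perm (Fin (n + 2))) :
    (Matrix.of fun i j : Fin (n + 2) => pderiv j (rename ((pairEquiv n hn).trans b) (Sum.elim
        (fun e => (X (Sum.inl e) : MvPolynomial _ K) - C (twist n ζ a e) * X (Sum.inr e))
        (fermatLinearCycleFactor (twist n ζ a) d) ((pairEquiv n hn).symm i)))).det ∉
      Ideal.span (Set.range fun i : Fin (n + 2) => (X i : MvPolynomial (Fin (n + 2)) K) ^ (d - 1)) := by
  have hc : ∀ e, twist n ζ a e ≠ 0 := fun e => pow_ne_zero _ hζ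
  rw [det_jacobian_presentationMV hn (by omega : 1 ≤ d)]
  intro hmem
  set ρ := (pairEquiv n hn).trans b with hρ
  set c := twist n ζ a with hc'
  -- strip the unit `sign(b) · d^{n/2+1}`
  have hunit : IsUnit (((Equiv.Perm.sign b : ℤ) : MvPolynomial (Fin (n + 2)) K) * C ((d : K) ^ (n / 2 + 1))) := by
    refine IsUnit.mul ?_ ((isUnit_iff_ne_zero.mpr (pow_ne_zero _ hdK)).map C)
    rcases Int.units_eq_one_or (Equiv.Perm.sign b) with h | h <;> rw [h] <;> simp
  rw [← mul_assoc] at hmem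
  have hmem' := (Ideal.unit_mul_mem_iff_mem _ hunit).mp hmem
  -- `linearCyclePolyMV = rename ρ (C(∏ c_e) · P_c)`
  have hpoly : linearCyclePolyMV n d ζ a b hn = rename ρ (C (∏ e, c e) * fermatLinearCyclePolynomial c (d - 1)) := by
    rw [map_mul, rename_C]
    rfl
  rw [hpoly] at hmem'
  -- pull back along `rename ρ⁻¹`: the generators `x_i^{d−1}` go to the generators `x_q^{d−1}` of the paired variables
  have himg := Ideal.mem_map_of_mem (rename ρ.symm) hmem'
  rw [rename_rename, Equiv.symm_comp_self, Ideal.map_span] at himg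
  have hid : rename (id : Fin (n / 2 + 1) ⊕ Fin (n / 2 + 1) → _)
      (C (∏ e, c e) * fermatLinearCyclePolynomial c (d - 1)) = C (∏ e, c e) * fermatLinearCyclePolynomial c (d - 1) := by
    rw [rename_id, AlgHom.id_apply]
  rw [hid] at himg
  have hJ : (rename ρ.symm : MvPolynomial (Fin (n + 2)) K →ₐ[K] _) ''
      (Set.range fun i : Fin (n + 2) => (X i : MvPolynomial (Fin (n + 2)) K) ^ (d - 1)) =
      Set.range fun q : Fin (n / 2 + 1) ⊕ Fin (n / 2 + 1) => (X q : MvPolynomial _ K) ^ (d - 1) := by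
    ext p
    simp only [Set.mem_image, Set.mem_range]
    constructor
    · rintro ⟨_, ⟨i, rfl⟩, rfl⟩
      exact ⟨ρ.symm i, by rw [map_pow, rename_X]⟩
    · rintro ⟨q, rfl⟩
      exact ⟨X (ρ q) ^ (d - 1), ⟨ρ q, rfl⟩, by rw [map_pow, rename_X, Equiv.symm_apply_apply]⟩
  rw [hJ] at himg
  -- strip `∏ c_e ≠ 0` and contradict `P_c ∉ J`
  have hprod : (∏ e, c e) ≠ 0 := Finset.prod_ne_zero_iff.mpr fun e _ => hc e
  exact fermatLinearCyclePolynomial_not_mem c (d - 1) (by omega)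
    ((Ideal.unit_mul_mem_iff_mem _ ((isUnit_iff_ne_zero.mpr hprod).map C)).mp himg)

end Literature.AlgebraicGeometry.Villaflor2022
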